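import Summits.AtomisticToContinuum.BoseEinsteinCondensation.Theorems.BECThomsonPrinciplePeriodicToDirichletDefs

/-!
# Line `reward-pays-the-wall` for crux `PeriodicToDirichlet` (stmt-AtomisticToContinuum-9483) — SKELETON
# (lead's second reshape, registration copy: 2 registered stubs — `stub_anchors` (landed, sorry-free over
# the six landed stubs of the first reshape) and `stub_unrewarding` (open residual) — composition sorry-free)

Route `BECThomsonPrinciple`; crux `PeriodicToDirichlet := PeriodicBEC → _root_.BoseEinsteinCondensation`.

First reshape (cycle 1, all LANDED `--supports stmt-AtomisticToContinuum-9483`): `stub_cutoffEnergy`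
(Defs file `Theorems/BECThomsonPrinciplePeriodicToDirichletDefs.lean`, p74246), `stub_cutoffOccupation`
(p75283), `stub_mergeOccupation` (p75829), `stub_paddedCutoffState` (p75196), `stub_rewardedUpperBound`
(p74991), `stub_rewardSandwich` (p74880); generic Literature lemmas p73428 BoseGasCutoffStateEnergy,
p73710 BoseGasPaddingStates, p73807 BoseGasBoxModeNested, p74059 BoseGasCutoffStateOccupation, p74015
BoseGasMergeOccupation, p73747 BoseGasSlabPadding, p73380 BoseGasDiluteEnergyFloor. They assemble into
the ANCHORS `AnchorsFromTorusBEC` (torus BEC at `(v,ρ,c)` ⟹ rewarded flat-mode BEC of the Dirichlet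
near-minimisers at the same density with uniform constant `min c 1 / 2` at every reward `λ > 0`), landed
as `Theorems/BECThomsonPrinciplePeriodicToDirichletAnchors.lean` (`stub_anchors`, sorry-free). The
boundary condition has thus disappeared from the crux; what remains is `stub_unrewarding : Unrewarding`
(the number-conserving `λ → 0⁺`/`N → ∞` un-rewarding in one Dirichlet cube; open, LSSY 2005 App. D
converse of (D.17); not refutable — Disproof §8, Negative/RewardedFreeGas*: at `v = 0` the constant
cannot be kept). This registration copy imports only the Defs module and restates
`AnchorsFromTorusBEC` verbatim (same namespace, definitionally the landed one).
-/

noncomputable section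

open MeasureTheory Filter
open scoped ENNReal NNReal

namespace Summit.AtomisticToContinuum.BoseEinsteinCondensation.RewardPaysTheWall

open Literature.MathematicalPhysics.QuantumManyBody.BoseGas

/-- **Statement of the anchors** (verbatim the landed `AnchorsFromTorusBEC` of
`Theorems/BECThomsonPrinciplePeriodicToDirichletAnchors.lean`). -/
def AnchorsFromTorusBEC : Prop :=
  ∀ v : ℝ → ℝ≥0∞, IsRepulsiveFiniteRange v → ∃ ρstar : ℝ, 0 < ρstar ∧ ∀ ρ : ℝ, 0 < ρ → ρ < ρstar →
    ∀ c : ℝ, 0 < c → TorusBECAt v ρ c → ∀ lam : ℝ, 0 < lam → RewardedBoxBECAt v ρ lam (min c 1 / 2)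

/-! ## Registered stubs -/

/-- **Stub A** (LANDED, sorry-free over the six landed stubs of the first reshape:
`Theorems/BECThomsonPrinciplePeriodicToDirichletAnchors.lean`): the anchors. -/
theorem stub_anchors : AnchorsFromTorusBEC := by
  sorry

/-- **Stub 4** (open-problem, HARDEST, lead): un-rewarding — see `Unrewarding` (Defs file). -/
theorem stub_unrewarding : Unrewarding := by
  sorry

/-! ## Composition (sorry-free): the two registered stubs give the crux BY NAME -/

/-- **The crux from the registered stubs (by name).** Given the crux hypothesis `A = PeriodicBEC`
and an admissible `v`: `A` gives `ρ_A` and, for `ρ < ρ_A`, a constant `c(ρ) > 0` with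
`TorusBECAt v ρ c` (definitional unfolding); `stub_anchors` gives rewarded flat-mode BEC with
constant `min c 1 / 2` at every `λ > 0` for `ρ < ρ*`; `stub_unrewarding` removes the reward for
`ρ < ρ₃`; the glue `hasGroundStateBEC_of_rewardedBoxBECAt_zero` gives `HasGroundStateBEC v ρ`;
hence the conjunct with `ρ₀ = min(ρ_A, ρ*, ρ₃)`. [folklore] -/
theorem periodicToDirichlet_of_registered_stubs :
    Summit.AtomisticToContinuum.BoseEinsteinCondensation.Theses.BECThomsonPrinciple.PeriodicToDirichlet := by
  intro hA v hv
  obtain ⟨ρA, hρA, HA⟩ := hA v hv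
  obtain ⟨ρs, hρs, Hs⟩ := stub_anchors v hv
  obtain ⟨ρ₃, hρ₃, H4⟩ := stub_unrewarding v hv
  refine ⟨min ρA (min ρs ρ₃), lt_min hρA (lt_min hρs hρ₃), fun ρ hρ hlt => ?_⟩
  obtain ⟨c, hc, hT⟩ := HA ρ hρ (hlt.trans_le (min_le_left _ _))
  have hR := Hs ρ hρ (hlt.trans_le ((min_le_right _ _).trans (min_le_left _ _))) c hc hT
  obtain ⟨c', hc', h0⟩ := H4 ρ hρ (hlt.trans_le ((min_le_right _ _).trans (min_le_right _ _)))
    (min c 1 / 2) (half_pos (lt_min hc one_pos)) hR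
  exact hasGroundStateBEC_of_rewardedBoxBECAt_zero hρ hc' h0

end Summit.AtomisticToContinuum.BoseEinsteinCondensation.RewardPaysTheWall

end
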